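import Summits.QuantumFields.BalabanUV.Gaps.D1ValueSockets
import Summits.QuantumFields.BalabanUV.Beta.GAN24.WSlotT2TablesAn1

/-!
# `BalabanUV.Gaps.D1ValueSocketsPinned` — cell pub-balaban-gaps, row (D1): the value sockets of `Gaps.D1ValueSockets` AT THE PINS
# §1 the (III′) literal of record at the lock NUMERALS `cΛ := 2∕Lc⁴`, `cB := −Lc¹²∕4` (the locks become `lock_mul_pow` ∕ `rfl`);
# §2 the β-lead's pinned literal `JsBalAn1` where the all-scales shape is a THEOREM (`GAN24.WSlotT2TablesAn1.allScalesSeq_secondMoment_JsBalAn1_pinned`):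
# THERE the socket is INHABITED hypothesis-free — `∃ κ θ, 0 ≤ θ < 1 ∧ ((D1) ↔ tube)` — instance 1∕1 at the pinned literal, 0∕1 at the (III′) literal of record

HONEST FRAMING (cell contract, verbatim): «discharging `BetaPertH` makes Bałaban's UV stability UNCONDITIONAL — a real constructive-QFT result;
it is NOT the continuum limit and NOT the Clay problem.»  HONEST DEPENDENCY (verbatim): «continuum YM on T⁴ ⇐ BetaPertH ∧ nine spine estimates
(0/9 proved); BetaPertH ⇐ (D1) ∧ (D4) ∧ CAP+tail; G-an2-4 gates asym, D1 and NE2/3/4.»  THIS MODULE DISCHARGES NOTHING: [folklore] instantiation BY NAME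
of `Gaps.D1ValueSockets` (this lineage, p362222) at the pins, with this lineage's `D1BinderEnds.lock_mul_pow` and gan24's
`WSlotT2TablesAn1.allScalesSeq_secondMoment_JsBalAn1_pinned` (the existence-side all-scales rate at `JsBalAn1`, hypothesis-free; its `κ θ` are
EXISTENTIAL — not numeric — so §2's socket is inhabited but still toothless in the sense of g1-plan-1 V16-1).  The twin statements at `JsBalAn1`
in LIMIT currency are g1-p3's `Gaps/CapTailPinnedLimitSign.d1Drift_pinned_iff_lim_eq` and gan24's `d1Drift_iff_three_JsBalAn1_pinned` (CALLED nowhere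
here, not restated).  Nothing of Bałaban's asserted; (D1) NOT discharged at either literal; 0∕4 row-D1 binders; NOT BetaPertH, NOT continuum, NOT Clay.
No `def`, no `def … : Prop`, nothing cited, 0 sorry.

ABSOLUTE RULE (cell charter, verbatim): «No internally-minted statement may enter as a cited fact. Every hypothesis is either kernel-proved in this
package or a verbatim quotation of a PUBLISHED theorem with page reference. The manuscript(s) under audit are NOT citable for their own disputed
steps — they are the thing under adjudication; programme-internal (2001/route/tribunal) claims are never citable.»

Provenance: cell pub-balaban-gaps, seat g1-p1 GEN 7 (prover-pub-balaban-gaps-g1-p1-g7-0), 2026-08-23; imports `Gaps.D1ValueSockets` + gan24's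
`Beta.GAN24.WSlotT2TablesAn1` (read-only, BY NAME); no existing file touched.
-/

noncomputable section

open Finset Filter Topology
open scoped BigOperators
open Literature.MathematicalPhysics.QuantumFieldTheory.Balaban1983to89
open Literature.MathematicalPhysics.QuantumFieldTheory.Balaban1983to89.Beta
open OneStepResolventKernel (JetData)
open OneStepKernelFamily (TbalOf TshotOf D1Drift)
open B12Beta (secondMoment)
open RemainderConstAllScales (AllScalesSeq)
open RateCertificate (CauchyRate)
open HessianTelescopingKKT (StepRecursion wStep)
open AffineAveraging (box)
open Summit.QuantumFields.BalabanUV.Beta.CombChartJointEnd (JsB12CombShSym)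
open Summit.QuantumFields.BalabanUV.Beta.SymSecondOrderTablesAn1 (symTablesAn1S2)
open Summit.QuantumFields.BalabanUV.Beta.SymmetrisedStepJets (SymTables)
open Summit.QuantumFields.BalabanUV.Beta.CombOneShotJetsTabs (JcOfTabs)
open Summit.QuantumFields.BalabanUV.Beta.MixedJetTablesPlug (JsBalAn1)
open Summit.QuantumFields.BalabanUV.Beta.GAN24.WSlotT2TablesAn1 (allScalesSeq_secondMoment_JsBalAn1_pinned)
open Summit.QuantumFields.BalabanUV.Beta.GAN24.StencilSlotOfE3 (one_le_of_two_le)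
open Summit.QuantumFields.BalabanUV.Gaps.D1Residue (OneShotLaw)
open Summit.QuantumFields.BalabanUV.Gaps.D1BinderEnds (lock_mul_pow)
open Summit.QuantumFields.BalabanUV.Gaps.D1ValueSockets

namespace Summit.QuantumFields.BalabanUV.Gaps.D1ValueSocketsPinned

variable {Lc : ℕ} [NeZero Lc]

/-! ## §1 The (III′) literal of record at the lock numerals `cΛ = 2∕Lc⁴`, `cB = −Lc¹²∕4` -/

section RecordPins

/-- [folklore] **THE ONE-SHOT-CURRENCY SOCKET AT THE PINNED LITERAL OF RECORD**: `Odd Lc`, `2 ≤ Lc`, `2 ≤ N`, a table record anchored on an1's at depth 1,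
an4's `StepRecursion`, row G-an2-4's all-scales rate `κ θ` of the (III′) step coefficients, and ONE composite block `Lc^m` (`m ≥ 1`) with
`κ∕(1−θ) < |secondMoment (TshotOf Lc (JcOfTabs hLc N tabs (2∕Lc⁴) (−Lc¹²∕4)) m) μ ν − stepBal Nc Lc·m|` ⟹ `¬ OneShotLaw` — NOTHING ELSE displayed
(the locks are `lock_mul_pow` ∕ `rfl`). -/
theorem not_oneShotLaw_pinned_of_oneShot_gap (hLc : Odd Lc) (hL2 : 2 ≤ Lc) {N : ℕ} (hN : 2 ≤ N) (tabs : ∀ m : ℕ, SymTables 3 (Lc ^ m))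
    (h1 : HEq (tabs 1) (symTablesAn1S2 3 Lc (2 / (Lc : ℝ) ^ 4)))
    (hrec : StepRecursion Lc (TbalOf Lc (JsB12CombShSym hLc N (symTablesAn1S2 3 Lc (2 / (Lc : ℝ) ^ 4)) (2 / (Lc : ℝ) ^ 4) (-((Lc : ℝ) ^ 12 / 4))))
      (TshotOf Lc (JcOfTabs hLc N tabs (fun _ => 2 / (Lc : ℝ) ^ 4) (fun _ => -((Lc : ℝ) ^ 12 / 4)))) (wStep Lc))
    {Nc : ℝ} {μ ν : Fin 4} {κ θ : ℝ}
    (hall : AllScalesSeq (fun j => secondMoment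
      (TbalOf Lc (JsB12CombShSym hLc N (symTablesAn1S2 3 Lc (2 / (Lc : ℝ) ^ 4)) (2 / (Lc : ℝ) ^ 4) (-((Lc : ℝ) ^ 12 / 4))) j) μ ν) κ θ)
    (hθ0 : 0 ≤ θ) (hθ1 : θ < 1) {m : ℕ} (hm : 1 ≤ m)
    (hgap : κ / (1 - θ) <
      |secondMoment (TshotOf Lc (JcOfTabs hLc N tabs (fun _ => 2 / (Lc : ℝ) ^ 4) (fun _ => -((Lc : ℝ) ^ 12 / 4))) m) μ ν
        - B12Normalization.stepBal Nc Lc * m|) :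
    ¬ OneShotLaw Lc (JcOfTabs hLc N tabs (fun _ => 2 / (Lc : ℝ) ^ 4) (fun _ => -((Lc : ℝ) ^ 12 / 4))) Nc μ ν :=
  not_oneShotLaw_of_oneShot_gap_of_stepRecursion hLc hL2 hN (fun _ => 2 / (Lc : ℝ) ^ 4) (fun _ => -((Lc : ℝ) ^ 12 / 4))
    (lock_mul_pow hL2) rfl tabs h1 hrec hall hθ0 hθ1 hm hgap

/-- [folklore] **THE EXACT MISSING LEMMA IN LIMIT CURRENCY AT THE PINNED LITERAL OF RECORD**: the same data without a gap ⟹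
`OneShotLaw … ↔ CauchyRate.lim β⁰ = stepBal Nc Lc`. -/
theorem oneShotLaw_pinned_iff_lim_eq (hLc : Odd Lc) (hL2 : 2 ≤ Lc) {N : ℕ} (hN : 2 ≤ N) (tabs : ∀ m : ℕ, SymTables 3 (Lc ^ m))
    (h1 : HEq (tabs 1) (symTablesAn1S2 3 Lc (2 / (Lc : ℝ) ^ 4)))
    (hrec : StepRecursion Lc (TbalOf Lc (JsB12CombShSym hLc N (symTablesAn1S2 3 Lc (2 / (Lc : ℝ) ^ 4)) (2 / (Lc : ℝ) ^ 4) (-((Lc : ℝ) ^ 12 / 4))))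
      (TshotOf Lc (JcOfTabs hLc N tabs (fun _ => 2 / (Lc : ℝ) ^ 4) (fun _ => -((Lc : ℝ) ^ 12 / 4)))) (wStep Lc))
    {Nc : ℝ} {μ ν : Fin 4} {κ θ : ℝ}
    (hall : AllScalesSeq (fun j => secondMoment
      (TbalOf Lc (JsB12CombShSym hLc N (symTablesAn1S2 3 Lc (2 / (Lc : ℝ) ^ 4)) (2 / (Lc : ℝ) ^ 4) (-((Lc : ℝ) ^ 12 / 4))) j) μ ν) κ θ)
    (hθ0 : 0 ≤ θ) (hθ1 : θ < 1) :
    OneShotLaw Lc (JcOfTabs hLc N tabs (fun _ => 2 / (Lc : ℝ) ^ 4) (fun _ => -((Lc : ℝ) ^ 12 / 4))) Nc μ ν ↔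
      CauchyRate.lim (fun j => secondMoment
        (TbalOf Lc (JsB12CombShSym hLc N (symTablesAn1S2 3 Lc (2 / (Lc : ℝ) ^ 4)) (2 / (Lc : ℝ) ^ 4) (-((Lc : ℝ) ^ 12 / 4))) j) μ ν) =
        B12Normalization.stepBal Nc Lc :=
  oneShotLaw_iff_lim_eq_of_stepRecursion hLc hL2 hN (fun _ => 2 / (Lc : ℝ) ^ 4) (fun _ => -((Lc : ℝ) ^ 12 / 4))
    (lock_mul_pow hL2) rfl tabs h1 hrec hall hθ0 hθ1

end RecordPins

/-! ## §2 The β-lead's pinned literal `JsBalAn1`: the socket INHABITED hypothesis-free (`∃ κ θ`) -/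

section BalAn1

variable {r : Fin (3 + 1) → ℕ}

/-- [folklore] **AT `JsBalAn1` THE VALUE SOCKET IS INHABITED**: for `2 ≤ Lc`, `r ∈ box 4 Lc` and ANY colour data there are `κ θ` with `0 ≤ θ < 1` such that
for EVERY numeral `N`, `D1Drift Lc (JsBalAn1 …) N μ ν ↔ ∀ j, |secondMoment (TbalOf Lc (JsBalAn1 …) j) μ ν − stepBal N Lc| ≤ κ·θ^j` — gan24's hypothesis-free
all-scales rate `allScalesSeq_secondMoment_JsBalAn1_pinned` fed to `D1ValueSockets.d1Drift_iff_forall_abs_sub_stepBal_le` (one `κ θ` for all `N`: the rate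
is the coefficients', the numeral only enters the slope). -/
theorem exists_tube_iff_d1Drift_JsBalAn1_pinned (hLc : 2 ≤ Lc) (hr : r ∈ box (3 + 1) Lc) (cE cVH cΛ cB : ℝ)
    (Tc : Fin 4 → Fin 4 → Fin 4 → Fin 4 → ℝ) (μ ν : Fin 4) :
    ∃ κ θ : ℝ, 0 ≤ θ ∧ θ < 1 ∧ ∀ N : ℝ,
      (D1Drift Lc (JsBalAn1 (one_le_of_two_le hLc) hr cE cVH cΛ ((Lc : ℝ) ^ (2 * (3 + 1))) cB Tc) N μ ν ↔
        ∀ j : ℕ, |secondMoment (TbalOf Lc (JsBalAn1 (one_le_of_two_le hLc) hr cE cVH cΛ ((Lc : ℝ) ^ (2 * (3 + 1))) cB Tc) j) μ ν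
          - B12Normalization.stepBal N Lc| ≤ κ * θ ^ j) := by
  obtain ⟨κ, θ, hθ0, hθ1, hall⟩ := allScalesSeq_secondMoment_JsBalAn1_pinned hLc hr cE cVH cΛ cB Tc μ ν
  exact ⟨κ, θ, hθ0, hθ1, fun N => d1Drift_iff_forall_abs_sub_stepBal_le _ hall hθ0 hθ1 N⟩

/-- [folklore] **… HENCE THE REFUTATION SOCKET AT `JsBalAn1` HOLDS FOR SOME `κ θ` (the same for every numeral `N`)**: one scale outside the tube kills
(D1) there — inhabited, existential constants. -/
theorem exists_socket_JsBalAn1_pinned (hLc : 2 ≤ Lc) (hr : r ∈ box (3 + 1) Lc) (cE cVH cΛ cB : ℝ)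
    (Tc : Fin 4 → Fin 4 → Fin 4 → Fin 4 → ℝ) (μ ν : Fin 4) :
    ∃ κ θ : ℝ, 0 ≤ θ ∧ θ < 1 ∧ ∀ (N : ℝ) (j : ℕ),
      κ * θ ^ j < |secondMoment (TbalOf Lc (JsBalAn1 (one_le_of_two_le hLc) hr cE cVH cΛ ((Lc : ℝ) ^ (2 * (3 + 1))) cB Tc) j) μ ν
          - B12Normalization.stepBal N Lc| →
        ¬ D1Drift Lc (JsBalAn1 (one_le_of_two_le hLc) hr cE cVH cΛ ((Lc : ℝ) ^ (2 * (3 + 1))) cB Tc) N μ ν := by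
  obtain ⟨κ, θ, hθ0, hθ1, hall⟩ := allScalesSeq_secondMoment_JsBalAn1_pinned hLc hr cE cVH cΛ cB Tc μ ν
  exact ⟨κ, θ, hθ0, hθ1, fun N j hgap => not_d1Drift_of_gap _ hall hθ1 hgap⟩

/-- [folklore] **… AND THE ENGINE's INTERVALS AT `JsBalAn1`**: for some `κ θ`, whenever (D1) holds there with numeral `N`, the slope `stepBal N Lc` lies in
EVERY interval `[β⁰_j − κθ^j, β⁰_j + κθ^j]`. -/
theorem exists_intervals_JsBalAn1_pinned (hLc : 2 ≤ Lc) (hr : r ∈ box (3 + 1) Lc) (cE cVH cΛ cB : ℝ)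
    (Tc : Fin 4 → Fin 4 → Fin 4 → Fin 4 → ℝ) (μ ν : Fin 4) :
    ∃ κ θ : ℝ, 0 ≤ θ ∧ θ < 1 ∧ ∀ N : ℝ,
      D1Drift Lc (JsBalAn1 (one_le_of_two_le hLc) hr cE cVH cΛ ((Lc : ℝ) ^ (2 * (3 + 1))) cB Tc) N μ ν →
        ∀ j : ℕ, B12Normalization.stepBal N Lc ∈
          Set.Icc (secondMoment (TbalOf Lc (JsBalAn1 (one_le_of_two_le hLc) hr cE cVH cΛ ((Lc : ℝ) ^ (2 * (3 + 1))) cB Tc) j) μ ν - κ * θ ^ j)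
            (secondMoment (TbalOf Lc (JsBalAn1 (one_le_of_two_le hLc) hr cE cVH cΛ ((Lc : ℝ) ^ (2 * (3 + 1))) cB Tc) j) μ ν + κ * θ ^ j) := by
  obtain ⟨κ, θ, hθ0, hθ1, hall⟩ := allScalesSeq_secondMoment_JsBalAn1_pinned hLc hr cE cVH cΛ cB Tc μ ν
  exact ⟨κ, θ, hθ0, hθ1, fun N hD j => stepBal_mem_Icc_of_d1Drift _ hall hθ1 hD j⟩

end BalAn1

end Summit.QuantumFields.BalabanUV.Gaps.D1ValueSocketsPinned

end
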